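import Literature.Geometry.Symplectic.McleanTubeNormalForm
import Literature.Geometry.Symplectic.McleanWrappingNumberNegative
import Literature.Geometry.Manifold.ShellCutoff
import HarnessLib

/-!
# McLean's Lemma 5.17 (`k = 1`) from the symplectic tube data

Topic `Literature/Geometry/Symplectic`; the final assembly of the fact seat of
`Literature.Geometry.Symplectic.mclean_divisorComplement_convex_four` (M. McLean, *The growth
rate of symplectic homology and affine varieties*, GAFA 22 (2012), Lemma 5.17 with Lemma 5.14,
case of one smooth component).

`mclean_convex_of_tubeData` proves the conclusion of the fact — a primitive `λ` of `ω` on the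
divisor complement `U` and an exhausting function `g` with `dg(X_λ) > 0` outside a compact set —
from the hypotheses of the fact together with the **tube data** of the divisor (the content of
McLean's Lemma 5.14 / the symplectic neighbourhood theorem, which is *not* proved here and enters
as hypotheses): an open set `V ⊇ N ∖ U`, a smooth squared-radius `r²` with `{r² > 0} ∩ V = U ∩ V`,
an open `W ⊆ U` containing the punctured tube `{0 < r² ≤ ε₀}`, carrying a free smooth circle
action preserving `r²` whose rotation field `X` is Hamiltonian for `-r²/2` (`ω(X, ·) = -½ d r²`)
and non-vanishing, closed sub-tubes `{x ∈ V | r² ≤ ε}`, a preconnected punctured tube and a point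
beyond the tube.  The proof chains the tree's pieces of McLean's argument:

1. `exists_tube_normalForm` (fibrewise normalisation, McLean p. 37): a correction `h` and a
   locally constant wrapping function `κ` on `W` with `(θ - dh)(X_{r²}) = -(r² + 2κ)`;
2. `κ` is constant (`= κ₀`) on the preconnected punctured tube;
3. `wrappingNumber_neg` (cut-off Stokes over the closed `N`): `κ₀ < 0` — after localising `h` to
   the tube with a radial bump (`exists_shell_cutoff`), so that the corrected primitive is smooth
   on all of `U`;
4. `exists_convex_of_local_correction` (gluing and exhaustion, McLean p. 37–38): with
   `δ = min(ε₀/5, -2κ₀)` the normal form gives `(θ - dh)(X_{r²}) = -(r² + 2κ₀) > 0` on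
   `{r² < δ}`, which is exactly its positivity input.

Everything is proved; no definitions, no named facts (D-0026).  What remains for the fact itself
is only the existence of the tube data (McLean (2012), Lemma 5.14).

## References

* M. McLean, *The growth rate of symplectic homology and affine varieties*, Geom. Funct. Anal. 22
  (2012), 369–442, Lemma 5.14, Lemma 5.17. [Mclean2012]
-/

noncomputable section

open scoped Manifold ContDiff Topology
open Set Function Filter
open Literature.Geometry.Kaehler Literature.Geometry.Manifold

namespace Literature.Geometry.Symplectic

variable {N : Type*} [TopologicalSpace N] [T2Space N] [CompactSpace N]
  [ChartedSpace (EuclideanSpace ℝ (Fin 4)) N] [IsManifold (𝓡 4) ∞ N]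

/-- **McLean's Lemma 5.17 (`k = 1`) from the tube data.**  For a closed pointwise-nondegenerate
smooth `2`-form `ω` on a closed `4`-manifold `N`, a smooth primitive `θ` of `ω` on an open `U`,
and tube data of `N ∖ U` as described in the module docstring, there are a smooth primitive `λ`
of `ω|_U`, a smooth exhausting `g : U → ℝ` and `C` with `dg(v) > 0` whenever `g ≥ C` and
`ι_v dλ = λ` (McLean (2012), Lemma 5.17, proof, pp. 36–38). [cite: Mclean2012, Lemma 5.17] -/
theorem mclean_convex_of_tubeData (s : MForm (𝓡 4) N ℝ 2) (hsm : IsSmoothForm s)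
    (hcl : IsClosedForm s)
    (hnd : ∀ (x : N) (v : TangentSpace (𝓡 4) x), v ≠ 0 →
      ∃ w : TangentSpace (𝓡 4) x, s x ![v, w] ≠ 0)
    {U W : TopologicalSpace.Opens N} (hWU : W ≤ U) (θ : MForm (𝓡 4) U ℝ 1)
    (hθ : IsSmoothForm θ) (hdθ : mextDeriv θ = s.pullback (𝓡 4) (Subtype.val : U → N))
    [MulAction Circle W]
    (hact : ContMDiff ((𝓡 1).prod (𝓡 4)) (𝓡 4) ∞ (fun p : Circle × W => p.1 • p.2))
    (hfree : ∀ (a : Circle) (x : W), a • x = x → a = 1)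
    (hX0 : ∀ x : W, (circleFundVec x : EuclideanSpace ℝ (Fin 4)) ≠ 0)
    (r2 : N → ℝ) (hr2 : ContMDiff (𝓡 4) 𝓘(ℝ, ℝ) ∞ r2)
    (hinv : ∀ (a : Circle) (x : W), r2 ((a • x : W) : N) = r2 (x : N))
    (hT4 : ∀ (x : W) (w : EuclideanSpace ℝ (Fin 4)),
      s (x : N) ![circleFundVec x, w] =
        mfderiv (𝓡 4) 𝓘(ℝ, ℝ) (fun y : W ↦ -(1 / 2) * r2 (y : N)) x w)
    {V : Set N} (hV : IsOpen V) (hUV : (U : Set N)ᶜ ⊆ V)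
    (hr2U : ∀ x ∈ V, 0 < r2 x ↔ x ∈ U) {ε₀ : ℝ} (hε₀ : 0 < ε₀)
    (htube : ∀ ε, 0 < ε → ε ≤ ε₀ → IsClosed {x | x ∈ V ∧ r2 x ≤ ε})
    (hshell : ∀ x ∈ V, x ∈ U → r2 x ≤ ε₀ → x ∈ W)
    (hconn : IsPreconnected {x : W | r2 (x : N) < ε₀})
    (hfar : ∃ x : N, x ∈ V → ε₀ < r2 x) :
    ∃ (lam : MForm (𝓡 4) U ℝ 1) (g : U → ℝ) (C : ℝ),
      IsSmoothForm lam ∧ mextDeriv lam = s.pullback (𝓡 4) (Subtype.val : U → N) ∧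
      ContMDiff (𝓡 4) 𝓘(ℝ, ℝ) ∞ g ∧ (∀ c : ℝ, IsCompact (g ⁻¹' Set.Iic c)) ∧
      ∀ x : U, C ≤ g x → ∀ v : TangentSpace (𝓡 4) x,
        (∀ w : TangentSpace (𝓡 4) x, mextDeriv lam x ![v, w] = lam x ![w]) →
        (0 : ℝ) < mfderiv (𝓡 4) 𝓘(ℝ, ℝ) g x v := by
  classical
  have hndW : ∀ x : W, ∀ v : EuclideanSpace ℝ (Fin 4), v ≠ 0 →
      ∃ w : EuclideanSpace ℝ (Fin 4), s (x : N) ![v, w] ≠ 0 := fun x v hv ↦ hnd x v hv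
  have hndU : ∀ x : U, ∀ v : EuclideanSpace ℝ (Fin 4), v ≠ 0 →
      ∃ w : EuclideanSpace ℝ (Fin 4), s (x : N) ![v, w] ≠ 0 := fun x v hv ↦ hnd x v hv
  -- (1) the tube normal form
  obtain ⟨h, κ, hh, hκlc, hκid, hnf⟩ :=
    exists_tube_normalForm hWU s hndW θ hθ hdθ hact hfree r2 hr2 hinv hT4
  -- (2) `κ` is constant on the punctured tube
  obtain ⟨κ₀, hκ₀⟩ : ∃ κ₀ : ℝ, ∀ x : W, r2 (x : N) < ε₀ → κ x = κ₀ := by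
    by_cases hP : ∃ p : W, r2 (p : N) < ε₀
    · obtain ⟨p, hp⟩ := hP
      exact ⟨κ p, fun x hx ↦ hκlc.apply_eq_of_isPreconnected hconn hx hp⟩
    · exact ⟨0, fun x hx ↦ absurd ⟨x, hx⟩ hP⟩
  -- (3) localise `h` to the tube: `h₁ = (1 - χ') h`, `χ'` the cut-off at levels `ε₀/2`, `ε₀`
  have hK : IsClosed {x | x ∈ V ∧ r2 x ≤ 2 * (ε₀ / 2)} := by
    rw [show 2 * (ε₀ / 2) = ε₀ by ring]
    exact htube ε₀ hε₀ le_rfl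
  obtain ⟨χ', g', hχ's, -, -, -, -, hχ'0, hχ'1, -, -, -⟩ :=
    exists_shell_cutoff (I := 𝓡 4) r2 hV (fun x _ ↦ hr2 x) (half_pos hε₀) hK
  obtain ⟨h₁, hh₁⟩ : ∃ h₁ : N → ℝ, h₁ = fun y ↦ (1 - χ' y) * h y := ⟨_, rfl⟩
  have hr2c : Continuous r2 := hr2.continuous
  -- `h₁ = h` near the points of `V` with `r² < ε₀/2`
  have hloc : ∀ x ∈ V, r2 x < ε₀ / 2 → ∀ᶠ y in 𝓝 x, h₁ y = h y := by
    intro x hxV hx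
    have hO : IsOpen (V ∩ r2 ⁻¹' Iio (ε₀ / 2)) :=
      hr2c.continuousOn.isOpen_inter_preimage hV isOpen_Iio
    filter_upwards [hO.mem_nhds ⟨hxV, hx⟩] with y hy
    rw [hh₁]
    simp [hχ'0 y hy.1 (le_of_lt hy.2)]
  -- `h₁ = 0` near the points off the closed tube `{x ∈ V | r² ≤ ε₀}`
  have hzero : ∀ x, ¬ (x ∈ V ∧ r2 x ≤ ε₀) → ∀ᶠ y in 𝓝 x, h₁ y = 0 := by
    intro x hx
    filter_upwards [(htube ε₀ hε₀ le_rfl).isOpen_compl.mem_nhds hx] with y hy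
    have hy1 : χ' y = 1 := hχ'1 y fun hyV ↦ by
      by_contra hlt
      exact hy ⟨hyV, by linarith [not_le.1 hlt]⟩
    rw [hh₁]
    simp [hy1]
  -- smoothness of `h₁` at the points of `U`
  have hh₁U : ∀ x ∈ (U : Set N), ContMDiffAt (𝓡 4) 𝓘(ℝ, ℝ) ∞ h₁ x := by
    intro x hxU
    by_cases hxK : x ∈ V ∧ r2 x ≤ ε₀
    · have hxW : x ∈ W := hshell x hxK.1 hxU hxK.2
      have h1 : ContMDiff (𝓡 4) 𝓘(ℝ, ℝ) ∞ fun y ↦ 1 - χ' y :=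
        (contDiff_const.sub contDiff_id).comp_contMDiff hχ's
      have hp : ContMDiffAt (𝓡 4) 𝓘(ℝ, ℝ × ℝ) ∞ (fun y ↦ (1 - χ' y, h y)) x :=
        (h1 x).prodMk_space (hh ⟨x, hxW⟩)
      rw [hh₁]
      exact contDiff_mul.comp_contMDiffAt hp
    · exact contMDiffAt_const.congr_of_eventuallyEq (hzero x hxK)
  -- `d h₁ = d h` at the points of `V` with `r² < ε₀/2`
  have hdloc : ∀ x ∈ V, r2 x < ε₀ / 2 →
      mextDeriv (MForm.ofFun (𝓡 4) h₁) x = mextDeriv (MForm.ofFun (𝓡 4) h) x := by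
    intro x hxV hx
    refine mextDeriv_congr_of_eventuallyEq ?_
    filter_upwards [hloc x hxV hx] with y hy
    ext v
    rw [MForm.ofFun_apply, MForm.ofFun_apply, hy]
  -- (4) `κ₀ < 0` by the cut-off Stokes argument, with `ε = ε₀/5`
  have hκneg : κ₀ < 0 := by
    refine wrappingNumber_neg s ⟨hsm, hcl⟩ hnd hWU θ hθ hdθ (fun x ↦ circleFundVec x) hX0 r2 h₁
      hV hUV (fun x _ ↦ hr2 x) hh₁U hr2U hT4 (ε := ε₀ / 5) (by positivity) ?_ ?_ ?_ ?_
    · exact htube _ (by positivity) (by linarith)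
    · intro x hxV hxU hx
      exact hshell x hxV hxU (by linarith)
    · obtain ⟨x, hx⟩ := hfar
      exact ⟨x, fun hxV ↦ by linarith [hx hxV]⟩
    · intro x hxV h1 h2
      have hlt : r2 (x : N) < ε₀ := by linarith
      rw [hdloc x hxV (by linarith), ← hκ₀ x hlt, hκid x]
      ring
  -- (5) gluing: positivity of `(θ - dh₁)(X_{r²})` near the divisor
  have hh₁UV : ∀ x ∈ (U : Set N) ∩ V, ContMDiffAt (𝓡 4) 𝓘(ℝ, ℝ) ∞ h₁ x :=
    fun x hx ↦ hh₁U x hx.1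
  have hδ : 0 < min (ε₀ / 5) (-2 * κ₀) := lt_min (by positivity) (by linarith)
  have hpos : ∀ x : U, (x : N) ∈ V → r2 x < min (ε₀ / 5) (-2 * κ₀) →
      ∀ u : EuclideanSpace ℝ (Fin 4),
      (∀ w : EuclideanSpace ℝ (Fin 4),
        s (x : N) ![u, w] = mfderiv (𝓡 4) 𝓘(ℝ, ℝ) r2 (x : N) w) →
      0 < θ x ![u] - mextDeriv (MForm.ofFun (𝓡 4) h₁) (x : N) ![u] := by
    intro x hxV hxδ u hu
    have hδ1 : min (ε₀ / 5) (-2 * κ₀) ≤ ε₀ / 5 := min_le_left _ _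
    have hδ2 : min (ε₀ / 5) (-2 * κ₀) ≤ -2 * κ₀ := min_le_right _ _
    have hxW : (x : N) ∈ W := hshell x hxV x.2 (by linarith)
    set x' : W := ⟨x, hxW⟩ with hx'
    have hincl : TopologicalSpace.Opens.inclusion hWU x' = x := Subtype.ext rfl
    have h1 := hnf x' u hu
    rw [hincl] at h1
    have hxm : ((x' : W) : N) = (x : N) := rfl
    rw [hxm] at h1
    rw [hdloc x hxV (by linarith), h1, hκ₀ x' (by show r2 (x : N) < ε₀; linarith)]
    linarith
  obtain ⟨lam, g, C, h1, h2, h3, h4, h5⟩ := exists_convex_of_local_correction s θ r2 h₁ hndU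
    hθ hdθ hV hUV (fun x _ ↦ hr2 x) hr2U hh₁UV hδ hpos
  exact ⟨lam, g, C, h1, h2, h3, h4, h5⟩

end Literature.Geometry.Symplectic
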